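import Literature.NumberTheory.DiophantineGeometry.WordHighestWeightSpecht
import Literature.NumberTheory.DiophantineGeometry.SymmetricGroupRepsSignTwist
import Literature.NumberTheory.DiophantineGeometry.SchurWeylPlethysmProofs
import Literature.NumberTheory.DiophantineGeometry.SchurWeylHighestWeightProofs
import Literature.RepresentationTheory.FiniteGroups.SymmetricGroupFrobeniusOrthogonality
import Mathlib.LinearAlgebra.PID
import HarnessLib

/-!
# The `𝔖_n`-character of a slice of the word model: functions on the words of a fixed content
# modulo relabelling, `|K_γ| · ∑_τ χ^μ(τ) χ_γ(τ) = n! · ∑_{κ ∈ K_γ} χ^μ(κ)` (Young–wreath subgroups)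

Topic `Literature/Computability/AlgebraicComplexity` (val-lit cell, board U1 = `IK2020_prop_10_1`,
part P3; also the multi-block twin of `BLMW11PerSliceCharacterProofs.lean` §1–§3). Sources:
W. Fulton, J. Harris, *Representation Theory*, GTM 129, §2.2 (2.9)–(2.10) (multiplicities by
characters), Ex. 3.13 / §3.3 (the permutation representation `ℂ[G/K]`, `⟨χ, χ_{ℂ[G/K]}⟩ =
|K|⁻¹ ∑_{κ ∈ K} χ(κ)`), Thm. 6.3 (Schur–Weyl); C. Ikenmeyer, U. Kandasamy, arXiv:1911.03990 §10
(Prop. 10.1 / Claim 10.2: the `stab ϱ`-invariants of the weight space `{λ}^{Dϱ}`); P. Bürgisser,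
J. M. Landsberg, L. Manivel, J. Weyman, SIAM J. Comput. 40 (2011) §5.5, §8.4 (the case
`γ = (δ^m)`, `stab γ = 𝔖_m`, `K_γ = 𝔖_m ≀ 𝔖_δ`).

## The object and the dictionary

For an alphabet `[m]`, a length `n` and a content vector `γ : [m] → ℕ`, the **slice space**
`sliceSpace k m n γ ⊆ (words [n] → [m]) → k` consists of the functions supported on the words of
content EXACTLY `γ` and invariant under every relabelling `σ ∈ stab γ = {σ ∈ 𝔖_m : γ ∘ σ = γ}` of
the letters. It is `𝔖_n`-stable (`sliceSpace_le_comap`); write `χ_γ` for its character. In the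
word model of `V^{⊗n}`, `V = k^m`, the functions supported on content-`γ` words are the weight
space of weight `γ`, so `sliceSpace k m n γ = ((V^{⊗n})^γ)^{stab γ}` — for IK 2020 §10 with
`γ = D·ϱ` (`ϱ ⊢_m d` padded by zeros, `n = dD`) this is the `𝔖_n`-module whose `[λ]`-multiplicity
is `dim ({λ}^{Dϱ})^{stab ϱ}` (Schur–Weyl), and for BLMW 2011 §5.5 with `γ = (δ^m)` it is
`perSliceSpace k m (mδ)`. For a word `w₀` of content `γ` put
`K_γ(w₀) = {τ ∈ 𝔖_n : σ ∘ w₀ ∘ τ = w₀ for some σ ∈ 𝔖_m}` (then automatically `σ ∈ stab γ`): the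
permutations of the positions mapping the fibres of `w₀` to fibres of letters of the same content
— for `γ = D·ϱ` a Young–wreath subgroup `≅ ∏_i 𝔖_{ρ̂_i} ≀ 𝔖_{iD}` (`ρ̂_i` letters of content `iD`),
for `γ = (δ^m)` the wreath product `blockPerms m δ = 𝔖_m ≀ 𝔖_δ` when `w₀` is the block word.
As `𝔖_n`-sets, {`stab γ`-orbits of content-`γ` words} `≅ 𝔖_n / K_γ(w₀)`, so `χ_γ` is the
permutation character of `𝔖_n / K_γ`.

## What is proved (theorem-only apart from the one definition `sliceSpace`; no named facts)

* `card_mul_sum_spechtCharacter_mul_character_of_slice` (hypothesis form: any `𝔖_n`-stable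
  submodule `X` with the membership description of `sliceSpace`, so that users may supply their own
  rendering of the object) and `card_mul_sum_spechtCharacter_mul_character_sliceSpace`:
  **`|K_γ(w₀)| · ∑_{τ ∈ 𝔖_n} χ^μ(τ) χ_γ(τ) = n! · ∑_{κ ∈ K_γ(w₀)} χ^μ(κ)`** for every `μ ⊢ n`, every
  word `w₀` of content `γ`, over any field of characteristic zero (`K_γ(w₀)` as a `Finset`).
* `sum_spechtCharacter_mul_character_sliceSpace_eq_finrank_invariants`: for a subgroup `K` with
  `τ ∈ K ↔ ∃ σ, σ ∘ w₀ ∘ τ = w₀` and `N ≥ ℓ(μ)`,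
  `∑_τ χ^μ(τ) χ_γ(τ) = n! · dim (HW_μ((k^N)^{⊗n}))^{K}` (`hwPermRep`, Schur–Weyl
  `character_hwPermRep`, Fulton–Harris (2.9) `Representation.card_inv_mul_sum_char_eq_finrank`).

Proof = the elementary count of `BLMW11PerSliceCharacterProofs.lean` with `𝔖_m ↦ stab γ`,
`(δ^m) ↦ γ`: `|stab γ| · χ_γ(τ) = #{(w, σ) : cont(w) = γ, σ ∘ w ∘ τ = w}` through the averaging
projector onto `X` (`LinearMap.trace_restrict_eq_of_forall_mem`); `#{σ : σ ∘ w₀ ∘ τ = w₀}` is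
`#{σ : σ ∘ w₀ = w₀}` on `K_γ(w₀)` and `0` off it; conjugation along `w = w₀ ∘ g`
(`spechtCharacter_conj`, orbit–stabilizer `sum_comp_perm_eq_card_stab_smul`); and the count
`#{σ : σ ∘ w₀ = w₀} · |K_γ(w₀)| = |Stab_{𝔖_n}(w₀)| · |stab γ|`.

HONEST FRAMING. Classical finite-group representation theory (permutation characters, Schur–Weyl)
in the tree's word model; bookkeeping for IK 2020 Prop. 10.1 / BLMW 2011 §5.5; nothing here bears
on VP versus VNP, which is NOT proved. One definition with body (`sliceSpace`), no named facts.

## References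

* [FultonHarrisGTM129] §2.2 (2.9)–(2.10), §3.3 / Ex. 3.13 (permutation representations), Thm. 6.3.
* [IkenmeyerKandasamy2019] C. Ikenmeyer, U. Kandasamy, arXiv:1911.03990, §10 (Prop. 10.1,
  Claim 10.2).
* [BurgisserEtAl2011] §5.5 (proof of Prop. 5.5.2), §8.4 Cor. 8.4.2.

## Tree

`Word`, `wordContent`, `sum_wordContent`, `wordContent_comp_perm`, `wordPerm_apply`, `wordPermRep`,
`wordPermRep_apply`, `hwPermRep`, `character_hwPermRep` (`TensorWordModel`, `SchurWeylHighestWeightProofs`,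
`SymmetricGroupRepsFinrankSpechtProofs`, `WordHighestWeightSpecht`); `spechtCharacter_conj`
(`SymmetricGroupReps`); `sum_comp_perm_eq_card_stab_smul` (`SymmetricGroupFrobeniusOrthogonality`);
Mathlib `LinearMap.trace_restrict_eq_of_forall_mem`, `LinearMap.trace_eq_matrix_trace`,
`Representation.subrepresentation`, `Representation.card_inv_mul_sum_char_eq_finrank`.
-/

noncomputable section

open scoped BigOperators
open Finset Module

namespace Literature.Computability.AlgebraicComplexity

open _root_.Literature.NumberTheory.DiophantineGeometry
open _root_.Literature.RepresentationTheory.FiniteGroups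

/-! ### §0 The slice space -/

section Def

variable (k : Type*) [Field k] (m n : ℕ)

/-- **The slice space of content `γ`**: functions on words `[n] → [m]` supported on the words of
content exactly `γ` (`wordContent w = γ`) and invariant under every relabelling of the letters
fixing `γ` (`y (σ ∘ u) = y u` whenever `γ ∘ σ = γ`). In the word model of `(k^m)^{⊗n}` this is
`((k^m)^{⊗n})^γ)^{stab γ}`, the `stab γ`-invariants of the weight space of weight `γ`; for
`γ = D·ϱ`, `n = dD` it is the `𝔖_n`-module of IK 2020 §10 whose `[λ]`-multiplicity is
`dim ({λ}^{Dϱ})^{stab ϱ}` (Claim 10.2 / Prop. 10.1), a permutation module `k[𝔖_n / K_γ]` with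
`K_γ ≅ ∏_i 𝔖_{ρ̂_i} ≀ 𝔖_{iD}`; for `γ = (δ^m)` it is BLMW's `((E^{⊗mδ})_0)^{𝔚_E}`
(`perSliceSpace`). [cite: IkenmeyerKandasamy2019, §10 (Claim 10.2)] -/
def sliceSpace (γ : Fin m → ℕ) : Submodule k (Word m n → k) where
  carrier := {y | (∀ u : Word m n, wordContent u ≠ γ → y u = 0) ∧
    ∀ σ : Equiv.Perm (Fin m), (∀ i, γ (σ i) = γ i) → ∀ u : Word m n, y (⇑σ ∘ u) = y u}
  add_mem' {y y'} hy hy' := ⟨fun u hu => by rw [Pi.add_apply, hy.1 u hu, hy'.1 u hu, add_zero],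
    fun σ hσ u => by rw [Pi.add_apply, Pi.add_apply, hy.2 σ hσ, hy'.2 σ hσ]⟩
  zero_mem' := ⟨fun _ _ => rfl, fun _ _ _ => rfl⟩
  smul_mem' c {y} hy := ⟨fun u hu => by rw [Pi.smul_apply, hy.1 u hu, smul_zero],
    fun σ hσ u => by rw [Pi.smul_apply, Pi.smul_apply, hy.2 σ hσ]⟩

variable {k m n}

/-- Membership in `sliceSpace` (unfolding lemma). [cite: IkenmeyerKandasamy2019, §10 (Claim 10.2)] -/
theorem mem_sliceSpace_iff (γ : Fin m → ℕ) (y : Word m n → k) :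
    y ∈ sliceSpace k m n γ ↔ (∀ u : Word m n, wordContent u ≠ γ → y u = 0) ∧
      ∀ σ : Equiv.Perm (Fin m), (∀ i, γ (σ i) = γ i) → ∀ u : Word m n, y (⇑σ ∘ u) = y u :=
  Iff.rfl

variable (k) in
/-- `sliceSpace` is stable under the permutations of the positions (content and relabelling are
position-blind; Fulton–Harris Lemma 6.22). [cite: FultonHarrisGTM129, §6.1 Lemma 6.22] -/
theorem sliceSpace_le_comap (γ : Fin m → ℕ) (τ : Equiv.Perm (Fin n)) :
    sliceSpace k m n γ ≤ (sliceSpace k m n γ).comap (wordPermRep k m n τ) := by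
  intro y hy
  refine ⟨fun u hu => ?_, fun σ hσ u => ?_⟩
  · rw [wordPermRep_apply, wordPerm_apply]
    refine hy.1 _ ?_
    intro h
    apply hu
    funext a
    rw [← congr_fun h a, wordContent_comp_perm]
  · rw [wordPermRep_apply, wordPerm_apply, wordPerm_apply]
    exact hy.2 σ hσ (u ∘ ⇑τ)

end Def

/-! ### §1 Counting relabellings along a word `w₀` of content `γ` -/

section Count

variable {m n : ℕ}

/-- Relabelling the letters permutes the content: `cont(σ ∘ u)_i = cont(u)_{σ⁻¹ i}`. [folklore] -/
private theorem wordContent_perm_comp (σ : Equiv.Perm (Fin m)) (u : Word m n) (i : Fin m) :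
    wordContent (⇑σ ∘ u) i = wordContent u (σ.symm i) := by
  unfold wordContent
  congr 1
  ext p
  simp only [mem_filter, mem_univ, true_and, Function.comp_apply, Equiv.apply_eq_iff_eq_symm_apply]

/-- A relabelling `σ` with `σ ∘ w ∘ τ = w` for a word `w` of content `γ` fixes `γ`. [folklore] -/
private theorem stab_of_comp_eq {γ : Fin m → ℕ} {w : Word m n} (hw : wordContent w = γ)
    {σ : Equiv.Perm (Fin m)} {τ : Equiv.Perm (Fin n)} (h : ⇑σ ∘ w ∘ ⇑τ = w) (i : Fin m) :
    γ (σ i) = γ i := by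
  have hc := congr_fun (congrArg wordContent h) (σ i)
  rw [wordContent_perm_comp, Equiv.symm_apply_apply, wordContent_comp_perm, hw] at hc
  exact hc.symm

/-- A relabelled word `σ ∘ w₀` has the content of `w₀` iff `σ` fixes that content. [folklore] -/
private theorem wordContent_perm_comp_eq_iff {γ : Fin m → ℕ} {w₀ : Word m n}
    (hw₀ : wordContent w₀ = γ) (σ : Equiv.Perm (Fin m)) :
    wordContent (⇑σ ∘ w₀) = γ ↔ ∀ i, γ (σ i) = γ i := by
  constructor
  · intro h i
    have hc := congr_fun h (σ i)
    rw [wordContent_perm_comp, Equiv.symm_apply_apply, hw₀] at hc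
    exact hc.symm
  · intro h
    funext a
    rw [wordContent_perm_comp, hw₀]
    have := h (σ.symm a)
    rw [Equiv.apply_symm_apply] at this
    exact this.symm

/-- On `K_γ(w₀)` the relabellings repairing `w₀ ∘ τ` form a coset of the pointwise fixator of the
letters of `w₀`: `#{σ : σ ∘ w₀ ∘ τ = w₀} = #{σ : σ ∘ w₀ = w₀}`. [folklore] -/
private theorem card_filter_comp_comp_eq_of_exists (w₀ : Word m n) {τ : Equiv.Perm (Fin n)}
    (hτ : ∃ σ : Equiv.Perm (Fin m), ⇑σ ∘ w₀ ∘ ⇑τ = w₀) :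
    (univ.filter fun σ : Equiv.Perm (Fin m) => ⇑σ ∘ w₀ ∘ ⇑τ = w₀).card =
      (univ.filter fun σ : Equiv.Perm (Fin m) => ⇑σ ∘ w₀ = w₀).card := by
  obtain ⟨σ₀, hσ₀⟩ := hτ
  -- `w₀ ∘ τ = σ₀⁻¹ ∘ w₀`
  have hwτ : w₀ ∘ ⇑τ = ⇑σ₀⁻¹ ∘ w₀ := by
    funext q
    have hq := congr_fun hσ₀ q
    simp only [Function.comp_apply] at hq ⊢
    rw [← hq, Equiv.Perm.coe_inv, Equiv.symm_apply_apply]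
  symm
  refine Finset.card_bij (fun σ _ => σ * σ₀) (fun σ hσ => ?_) (fun σ _ σ' _ h => mul_right_cancel h)
    (fun σ hσ => ?_)
  · simp only [mem_filter, mem_univ, true_and] at hσ ⊢
    funext q
    have h1 := congr_fun hwτ q
    have h2 := congr_fun hσ q
    simp only [Function.comp_apply] at h1 h2 ⊢
    rw [h1, Equiv.Perm.coe_mul, Function.comp_apply, Equiv.Perm.coe_inv, Equiv.apply_symm_apply,
      h2]
  · simp only [mem_filter, mem_univ, true_and] at hσ
    refine ⟨σ * σ₀⁻¹, ?_, by rw [inv_mul_cancel_right]⟩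
    simp only [mem_filter, mem_univ, true_and]
    funext q
    have h1 := congr_fun hwτ q
    have h2 := congr_fun hσ q
    simp only [Function.comp_apply] at h1 h2 ⊢
    rw [h1] at h2
    rw [Equiv.Perm.coe_mul, Function.comp_apply]
    exact h2

/-- Off `K_γ(w₀)` no relabelling repairs `w₀ ∘ τ`. [folklore] -/
private theorem card_filter_comp_comp_eq_of_not_exists (w₀ : Word m n) {τ : Equiv.Perm (Fin n)}
    (hτ : ¬ ∃ σ : Equiv.Perm (Fin m), ⇑σ ∘ w₀ ∘ ⇑τ = w₀) :
    (univ.filter fun σ : Equiv.Perm (Fin m) => ⇑σ ∘ w₀ ∘ ⇑τ = w₀).card = 0 := by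
  rw [Finset.card_eq_zero, Finset.filter_eq_empty_iff]
  exact fun σ _ h => hτ ⟨σ, h⟩

/-- Weighting by `#{σ : σ ∘ w₀ ∘ τ = w₀}` and summing over all `τ ∈ 𝔖_n` is `#{σ : σ ∘ w₀ = w₀}`
times the sum over `K_γ(w₀)`. [folklore] -/
private theorem sum_card_filter_comp_comp_smul {M : Type*} [AddCommMonoid M] (w₀ : Word m n)
    (f : Equiv.Perm (Fin n) → M) :
    ∑ τ : Equiv.Perm (Fin n),
        (univ.filter fun σ : Equiv.Perm (Fin m) => ⇑σ ∘ w₀ ∘ ⇑τ = w₀).card • f τ =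
      (univ.filter fun σ : Equiv.Perm (Fin m) => ⇑σ ∘ w₀ = w₀).card •
        ∑ τ ∈ univ.filter (fun τ : Equiv.Perm (Fin n) =>
          ∃ σ : Equiv.Perm (Fin m), ⇑σ ∘ w₀ ∘ ⇑τ = w₀), f τ := by
  rw [Finset.smul_sum, Finset.sum_filter]
  refine Finset.sum_congr rfl fun τ _ => ?_
  by_cases hτ : ∃ σ : Equiv.Perm (Fin m), ⇑σ ∘ w₀ ∘ ⇑τ = w₀
  · rw [if_pos hτ, card_filter_comp_comp_eq_of_exists w₀ hτ]
  · rw [if_neg hτ, card_filter_comp_comp_eq_of_not_exists w₀ hτ, zero_smul]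

/-- **`#{σ : σ ∘ w₀ = w₀} · |K_γ(w₀)| = |Stab_{𝔖_n}(w₀)| · |stab γ|`**: `K_γ(w₀)` is an extension
of the image of `stab γ` (all of it: every `σ ∈ stab γ` relabels `w₀` into a word of the same
content, hence of the form `w₀ ∘ g`) by the position stabilizer of `w₀`; counted through the
relabellings `σ ∘ w₀`, `σ ∈ stab γ`. [folklore] -/
private theorem card_fix_mul_card_K (γ : Fin m → ℕ) (w₀ : Word m n) (hw₀ : wordContent w₀ = γ) :
    (univ.filter fun σ : Equiv.Perm (Fin m) => ⇑σ ∘ w₀ = w₀).card *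
        (univ.filter fun τ : Equiv.Perm (Fin n) =>
          ∃ σ : Equiv.Perm (Fin m), ⇑σ ∘ w₀ ∘ ⇑τ = w₀).card =
      (univ.filter fun g : Equiv.Perm (Fin n) => w₀ ∘ ⇑g = w₀).card *
        (univ.filter fun σ : Equiv.Perm (Fin m) => ∀ i, γ (σ i) = γ i).card := by
  have key := sum_comp_perm_eq_card_stab_smul w₀
    (fun w => (univ.filter fun σ : Equiv.Perm (Fin m) => ⇑σ ∘ w₀ = w).card)
  have hL : ∑ g : Equiv.Perm (Fin n),
      (univ.filter fun σ : Equiv.Perm (Fin m) => ⇑σ ∘ w₀ = w₀ ∘ ⇑g).card =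
      (univ.filter fun σ : Equiv.Perm (Fin m) => ⇑σ ∘ w₀ = w₀).card *
        (univ.filter fun τ : Equiv.Perm (Fin n) =>
          ∃ σ : Equiv.Perm (Fin m), ⇑σ ∘ w₀ ∘ ⇑τ = w₀).card := by
    have h1 : ∑ g : Equiv.Perm (Fin n),
        (univ.filter fun σ : Equiv.Perm (Fin m) => ⇑σ ∘ w₀ = w₀ ∘ ⇑g).card =
        ∑ g : Equiv.Perm (Fin n), (univ.filter fun σ : Equiv.Perm (Fin m) =>
          ⇑σ ∘ w₀ ∘ ⇑g = w₀).card • (1 : ℕ) := by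
      refine Fintype.sum_equiv (Equiv.inv _) _ _ fun g => ?_
      rw [smul_eq_mul, mul_one, Equiv.inv_apply]
      congr 1
      ext σ
      simp only [mem_filter, mem_univ, true_and]
      constructor
      · intro h
        funext q
        have hq := congr_fun h (g⁻¹ q)
        simp only [Function.comp_apply, Equiv.Perm.coe_inv, Equiv.apply_symm_apply] at hq
        simp only [Function.comp_apply, Equiv.Perm.coe_inv]
        exact hq
      · intro h
        funext q
        have hq := congr_fun h (g q)
        simp only [Function.comp_apply, Equiv.Perm.coe_inv, Equiv.symm_apply_apply] at hq
        simp only [Function.comp_apply]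
        exact hq
    rw [h1, sum_card_filter_comp_comp_smul w₀ (fun _ => (1 : ℕ))]
    simp only [Finset.sum_const, smul_eq_mul, mul_one]
  have hR : ∑ u ∈ univ.filter (fun u : Fin n → Fin m =>
      ∀ a, (univ.filter fun p => u p = a).card = (univ.filter fun p => w₀ p = a).card),
      (univ.filter fun σ : Equiv.Perm (Fin m) => ⇑σ ∘ w₀ = u).card =
      (univ.filter fun σ : Equiv.Perm (Fin m) => ∀ i, γ (σ i) = γ i).card := by
    rw [Finset.sum_card_fiberwise_eq_card_filter]
    congr 1
    ext σ
    simp only [mem_filter, mem_univ, true_and]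
    rw [← wordContent_perm_comp_eq_iff hw₀ σ]
    constructor
    · intro h
      funext a
      rw [← hw₀]
      exact h a
    · intro h a
      have := congr_fun h a
      rw [← hw₀] at this
      exact this
  rw [hL, smul_eq_mul] at key
  rw [key]
  congr 1
  convert hR using 10

end Count

/-! ### §2 The character of `𝔖_n` on a slice as a count -/

section Trace

variable (k : Type*) [Field k] [CharZero k] {m n : ℕ}

/-- **`|stab γ| · χ_X(τ) = #{(w, σ) : cont(w) = γ, σ ∘ w ∘ τ = w}`** for an `𝔖_n`-stable
submodule `X` described as the slice of content `γ` (`χ_X` its character): `X` is the image of the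
averaging projector `(Qy)(w) = [cont(w) = γ] · |stab γ|⁻¹ ∑_{σ ∈ stab γ} y(σ ∘ w)`, which commutes
with `𝔖_n`, so `χ_X(τ) = tr(τ ∘ Q)` on all functions of words. (The relabellings `σ` with
`σ ∘ w ∘ τ = w` lie in `stab γ` automatically, `stab_of_comp_eq`.)
[cite: FultonHarrisGTM129, §2.2 (2.9)] -/
private theorem card_stab_mul_character_of_slice (γ : Fin m → ℕ) (X : Submodule k (Word m n → k))
    (hX : ∀ y, y ∈ X ↔ (∀ u : Word m n, wordContent u ≠ γ → y u = 0) ∧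
      ∀ σ : Equiv.Perm (Fin m), (∀ i, γ (σ i) = γ i) → ∀ u : Word m n, y (⇑σ ∘ u) = y u)
    (hXc : ∀ τ, X ≤ X.comap (wordPermRep k m n τ)) (τ : Equiv.Perm (Fin n)) :
    ((univ.filter fun σ : Equiv.Perm (Fin m) => ∀ i, γ (σ i) = γ i).card : k) *
        ((wordPermRep k m n).subrepresentation X hXc).character τ =
      ∑ w ∈ univ.filter (fun w : Word m n => wordContent w = γ),
        ((univ.filter fun σ : Equiv.Perm (Fin m) => ⇑σ ∘ w ∘ ⇑τ = w).card : k) := by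
  set S := univ.filter (fun σ : Equiv.Perm (Fin m) => ∀ i, γ (σ i) = γ i) with hS
  have hS1 : (1 : Equiv.Perm (Fin m)) ∈ S := by simp [hS]
  have hS0 : (S.card : k) ≠ 0 := Nat.cast_ne_zero.mpr (Finset.card_pos.mpr ⟨1, hS1⟩).ne'
  have hSmul : ∀ {σ σ' : Equiv.Perm (Fin m)}, σ ∈ S → σ' ∈ S → σ' * σ ∈ S := by
    intro σ σ' hσ hσ'
    simp only [hS, mem_filter, mem_univ, true_and, Equiv.Perm.coe_mul, Function.comp_apply] at hσ hσ' ⊢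
    intro i
    rw [hσ', hσ]
  -- the averaging projector onto `X`
  let Q : (Word m n → k) →ₗ[k] (Word m n → k) :=
    { toFun := fun y w => if wordContent w = γ then (S.card : k)⁻¹ * ∑ σ ∈ S, y (⇑σ ∘ w) else 0
      map_add' := fun y y' => by
        funext w
        simp only [Pi.add_apply]
        split_ifs
        · rw [Finset.sum_add_distrib, mul_add]
        · rw [add_zero]
      map_smul' := fun c y => by
        funext w
        simp only [Pi.smul_apply, smul_eq_mul, RingHom.id_apply]
        split_ifs
        · rw [Finset.mul_sum, Finset.mul_sum, Finset.mul_sum]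
          exact Finset.sum_congr rfl fun σ _ => by ring
        · rw [mul_zero] }
  have hQ_apply : ∀ y w, Q y w =
      if wordContent w = γ then (S.card : k)⁻¹ * ∑ σ ∈ S, y (⇑σ ∘ w) else 0 := fun _ _ => rfl
  -- `Q` lands in `X`
  have hQ_mem : ∀ y, Q y ∈ X := by
    intro y
    rw [hX]
    refine ⟨fun u hu => ?_, fun σ hσ u => ?_⟩
    · rw [hQ_apply, if_neg hu]
    · rw [hQ_apply, hQ_apply]
      have hc : wordContent (⇑σ ∘ u) = γ ↔ wordContent u = γ := by
        constructor
        · intro h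
          funext i
          have := congr_fun h (σ i)
          rw [wordContent_perm_comp, Equiv.symm_apply_apply, hσ] at this
          exact this
        · intro h
          funext i
          rw [wordContent_perm_comp, h]
          have := hσ (σ.symm i)
          rw [Equiv.apply_symm_apply] at this
          exact this.symm
      by_cases hu : wordContent u = γ
      · rw [if_pos (hc.mpr hu), if_pos hu]
        congr 1
        have hσS : σ ∈ S := by simp [hS, hσ]
        refine Finset.sum_bij (fun σ' _ => σ' * σ) (fun σ' hσ' => hSmul hσS hσ')
          (fun σ' _ σ'' _ h => mul_right_cancel h) (fun σ' hσ' => ?_) (fun σ' _ => rfl)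
        exact ⟨σ' * σ⁻¹, hSmul (by
          simp only [hS, mem_filter, mem_univ, true_and] at hσS ⊢
          intro i
          have := hσS (σ⁻¹ i)
          rw [Equiv.Perm.coe_inv, Equiv.apply_symm_apply] at this
          rw [Equiv.Perm.coe_inv]
          exact this.symm) hσ', by rw [inv_mul_cancel_right]⟩
      · rw [if_neg (fun h => hu (hc.mp h)), if_neg hu]
  -- `Q` is the identity on `X`
  have hQ_id : ∀ y ∈ X, Q y = y := by
    intro y hy
    rw [hX] at hy
    funext w
    rw [hQ_apply]
    split_ifs with hw
    · rw [Finset.sum_congr rfl fun σ hσ => hy.2 σ (by simpa [hS] using hσ) w, Finset.sum_const,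
        nsmul_eq_mul, ← mul_assoc, inv_mul_cancel₀ hS0, one_mul]
    · exact (hy.1 w hw).symm
  -- transfer the trace to all functions of words
  have hf : ∀ x, (wordPermRep k m n τ ∘ₗ Q) x ∈ X := fun x => hXc τ (hQ_mem x)
  have hres : (wordPermRep k m n).subrepresentation X hXc τ =
      (wordPermRep k m n τ ∘ₗ Q).restrict (fun x _ => hf x) := by
    apply LinearMap.ext
    rintro ⟨y, hy⟩
    apply Subtype.ext
    simp only [Representation.subrepresentation_apply, LinearMap.coe_restrict_apply,
      LinearMap.coe_comp, Function.comp_apply, hQ_id y hy]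
  have htr : ((wordPermRep k m n).subrepresentation X hXc).character τ =
      LinearMap.trace k (Word m n → k) (wordPermRep k m n τ ∘ₗ Q) := by
    change LinearMap.trace k _ _ = _
    rw [hres]
    exact LinearMap.trace_restrict_eq_of_forall_mem _ _ hf
  rw [htr, LinearMap.trace_eq_matrix_trace k (Pi.basisFun k (Word m n)), Matrix.trace,
    Finset.mul_sum, Finset.sum_filter]
  refine Finset.sum_congr rfl fun w _ => ?_
  rw [Matrix.diag_apply, LinearMap.toMatrix_apply, Pi.basisFun_apply, Pi.basisFun_repr,
    LinearMap.coe_comp, Function.comp_apply, wordPermRep_apply, wordPerm_apply, hQ_apply]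
  have hcw : wordContent (w ∘ ⇑τ) = γ ↔ wordContent w = γ := by
    constructor <;> intro h <;> funext a <;> have := congr_fun h a <;>
      simp only [wordContent_comp_perm] at this ⊢ <;> exact this
  by_cases hw : wordContent w = γ
  · rw [if_pos (hcw.mpr hw), if_pos hw, ← mul_assoc, mul_inv_cancel₀ hS0, one_mul]
    simp only [Pi.single_apply]
    rw [Finset.sum_boole]
    -- the relabellings repairing `w ∘ τ` lie in `stab γ`
    congr 2
    ext σ
    simp only [hS, mem_filter, mem_univ, true_and, and_iff_right_iff_imp]
    exact fun h i => stab_of_comp_eq hw h i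
  · rw [if_neg (fun h => hw (hcw.mp h)), if_neg hw, mul_zero]

end Trace

/-! ### §3 `|K_γ(w₀)| · ∑_τ χ^μ(τ) χ_γ(τ) = n! · ∑_{κ ∈ K_γ(w₀)} χ^μ(κ)` -/

section Main

variable (k : Type*) [Field k] [CharZero k] {m n : ℕ}

/-- **The multiplicity of `[μ]` in a slice, hypothesis form** (any `𝔖_n`-stable submodule `X`
with the membership description of `sliceSpace k m n γ`; any word `w₀` of content `γ`; any field of
characteristic zero): `|K_γ(w₀)| · ∑_{τ ∈ 𝔖_n} χ^μ(τ) χ_X(τ) = n! · ∑_{κ ∈ K_γ(w₀)} χ^μ(κ)`,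
`K_γ(w₀) = {τ : ∃ σ, σ ∘ w₀ ∘ τ = w₀}` — the slice is the permutation module `k[𝔖_n/K_γ]` and
`⟨χ^μ, χ_{k[𝔖_n/K]}⟩ = |K|⁻¹ ∑_{κ ∈ K} χ^μ(κ)` (Fulton–Harris §3.3 / Ex. 3.13, (2.9)).
[cite: FultonHarrisGTM129, §2.2 (2.9) and §3.3] -/
theorem card_mul_sum_spechtCharacter_mul_character_of_slice (γ : Fin m → ℕ)
    (X : Submodule k (Word m n → k))
    (hX : ∀ y, y ∈ X ↔ (∀ u : Word m n, wordContent u ≠ γ → y u = 0) ∧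
      ∀ σ : Equiv.Perm (Fin m), (∀ i, γ (σ i) = γ i) → ∀ u : Word m n, y (⇑σ ∘ u) = y u)
    (hXc : ∀ τ, X ≤ X.comap (wordPermRep k m n τ)) (w₀ : Word m n) (hw₀ : wordContent w₀ = γ)
    (μ : Nat.Partition n) :
    ((univ.filter fun τ : Equiv.Perm (Fin n) =>
        ∃ σ : Equiv.Perm (Fin m), ⇑σ ∘ w₀ ∘ ⇑τ = w₀).card : k) *
      ∑ τ : Equiv.Perm (Fin n), spechtCharacter k μ τ *
        ((wordPermRep k m n).subrepresentation X hXc).character τ =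
      (n.factorial : k) * ∑ τ ∈ univ.filter (fun τ : Equiv.Perm (Fin n) =>
        ∃ σ : Equiv.Perm (Fin m), ⇑σ ∘ w₀ ∘ ⇑τ = w₀), spechtCharacter k μ τ := by
  -- abbreviations: `S = stab γ`, `f = #{σ : σ ∘ w₀ = w₀}`, `s = |Stab(w₀)|`
  have hS0 : ((univ.filter fun σ : Equiv.Perm (Fin m) => ∀ i, γ (σ i) = γ i).card : k) ≠ 0 :=
    Nat.cast_ne_zero.mpr (Finset.card_pos.mpr ⟨1, by simp⟩).ne'
  have hf0 : ((univ.filter fun σ : Equiv.Perm (Fin m) => ⇑σ ∘ w₀ = w₀).card : k) ≠ 0 :=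
    Nat.cast_ne_zero.mpr (Finset.card_pos.mpr ⟨1, by simp⟩).ne'
  have hs0 : ((univ.filter fun g : Equiv.Perm (Fin n) => w₀ ∘ ⇑g = w₀).card : k) ≠ 0 :=
    Nat.cast_ne_zero.mpr (Finset.card_pos.mpr ⟨1, by simp⟩).ne'
  -- the orbit sum `F(w) = ∑_τ #{σ | σ ∘ w ∘ τ = w} χ^μ(τ)`
  set F : Word m n → k := fun w => ∑ τ : Equiv.Perm (Fin n),
    ((univ.filter fun σ : Equiv.Perm (Fin m) => ⇑σ ∘ w ∘ ⇑τ = w).card : k) * spechtCharacter k μ τ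
    with hF
  -- (1) `|S| ∑_τ χ^μ χ_X = ∑_{cont w = γ} F w`
  have h1 : ((univ.filter fun σ : Equiv.Perm (Fin m) => ∀ i, γ (σ i) = γ i).card : k) *
      ∑ τ : Equiv.Perm (Fin n), spechtCharacter k μ τ *
        ((wordPermRep k m n).subrepresentation X hXc).character τ =
      ∑ w ∈ univ.filter (fun w : Word m n => wordContent w = γ), F w := by
    rw [Finset.mul_sum]
    have key : ∀ τ : Equiv.Perm (Fin n),
        ((univ.filter fun σ : Equiv.Perm (Fin m) => ∀ i, γ (σ i) = γ i).card : k) *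
          (spechtCharacter k μ τ * ((wordPermRep k m n).subrepresentation X hXc).character τ) =
        ∑ w ∈ univ.filter (fun w : Word m n => wordContent w = γ),
          ((univ.filter fun σ : Equiv.Perm (Fin m) => ⇑σ ∘ w ∘ ⇑τ = w).card : k) *
            spechtCharacter k μ τ := by
      intro τ
      rw [mul_left_comm, card_stab_mul_character_of_slice k γ X hX hXc τ, Finset.mul_sum]
      exact Finset.sum_congr rfl fun w _ => mul_comm _ _
    rw [Finset.sum_congr rfl fun τ _ => key τ, Finset.sum_comm]
  -- (2) content `γ` = content of `w₀`
  have hCT : (univ.filter fun w : Word m n => wordContent w = γ) =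
      univ.filter fun u : Fin n → Fin m =>
        ∀ a, (univ.filter fun p => u p = a).card = (univ.filter fun p => w₀ p = a).card := by
    ext w
    simp only [mem_filter, mem_univ, true_and]
    constructor
    · intro h a
      have h1 := congr_fun h a
      have h2 := congr_fun hw₀ a
      unfold wordContent at h1 h2
      rw [h1, h2]
    · intro h
      funext a
      rw [← congr_fun hw₀ a]
      exact h a
  -- (3) `F` is constant along the orbit of `w₀` (conjugation)
  have hconj : ∀ g : Equiv.Perm (Fin n), F (w₀ ∘ ⇑g) = F w₀ := by
    intro g
    simp only [hF]
    refine Fintype.sum_equiv (MulAut.conj g).toEquiv _ _ fun τ => ?_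
    simp only [MulEquiv.toEquiv_eq_coe, MulEquiv.coe_toEquiv, MulAut.conj_apply]
    rw [spechtCharacter_conj]
    congr 3
    ext σ
    simp only [mem_filter, mem_univ, true_and]
    constructor
    · intro h
      funext q
      have hq := congr_fun h (g⁻¹ q)
      simp only [Function.comp_apply, Equiv.Perm.coe_inv, Equiv.apply_symm_apply] at hq
      simp only [Function.comp_apply, Equiv.Perm.coe_mul, Equiv.Perm.coe_inv]
      exact hq
    · intro h
      funext q
      have hq := congr_fun h (g q)
      simp only [Function.comp_apply, Equiv.Perm.coe_mul, Equiv.Perm.coe_inv,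
        Equiv.symm_apply_apply] at hq
      simp only [Function.comp_apply]
      exact hq
  -- (4) `F(w₀) = f · ∑_{K} χ^μ`
  have hF0 : F w₀ = ((univ.filter fun σ : Equiv.Perm (Fin m) => ⇑σ ∘ w₀ = w₀).card : k) *
      ∑ τ ∈ univ.filter (fun τ : Equiv.Perm (Fin n) =>
        ∃ σ : Equiv.Perm (Fin m), ⇑σ ∘ w₀ ∘ ⇑τ = w₀), spechtCharacter k μ τ := by
    simp only [hF]
    have h := sum_card_filter_comp_comp_smul (M := k) w₀ (spechtCharacter k μ)
    simp only [nsmul_eq_mul] at h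
    exact h
  -- (5) orbit–stabilizer: `n! · F(w₀) = s · ∑_{cont(w) = γ} F(w)`
  have key : ∑ g : Equiv.Perm (Fin n), F (w₀ ∘ ⇑g) =
      (univ.filter fun g : Equiv.Perm (Fin n) => w₀ ∘ ⇑g = w₀).card •
        ∑ w ∈ univ.filter (fun w : Word m n => wordContent w = γ), F w := by
    rw [hCT]
    convert sum_comp_perm_eq_card_stab_smul w₀ F using 10
  rw [Finset.sum_congr rfl fun g _ => hconj g, Finset.sum_const, Finset.card_univ,
    Fintype.card_perm, Fintype.card_fin, hF0, ← h1, nsmul_eq_mul, nsmul_eq_mul] at key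
  -- (6) the count `f · |K| = s · |S|`
  have hcount := card_fix_mul_card_K γ w₀ hw₀
  have hcount' : ((univ.filter fun σ : Equiv.Perm (Fin m) => ⇑σ ∘ w₀ = w₀).card : k) *
      ((univ.filter fun τ : Equiv.Perm (Fin n) =>
        ∃ σ : Equiv.Perm (Fin m), ⇑σ ∘ w₀ ∘ ⇑τ = w₀).card : k) =
      ((univ.filter fun g : Equiv.Perm (Fin n) => w₀ ∘ ⇑g = w₀).card : k) *
        ((univ.filter fun σ : Equiv.Perm (Fin m) => ∀ i, γ (σ i) = γ i).card : k) := by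
    exact_mod_cast hcount
  -- assemble: multiply the goal by `f`
  refine mul_left_cancel₀ hf0 ?_
  calc ((univ.filter fun σ : Equiv.Perm (Fin m) => ⇑σ ∘ w₀ = w₀).card : k) *
        ((((univ.filter fun τ : Equiv.Perm (Fin n) =>
            ∃ σ : Equiv.Perm (Fin m), ⇑σ ∘ w₀ ∘ ⇑τ = w₀).card : k)) *
          ∑ τ : Equiv.Perm (Fin n), spechtCharacter k μ τ *
            ((wordPermRep k m n).subrepresentation X hXc).character τ)
      = ((univ.filter fun g : Equiv.Perm (Fin n) => w₀ ∘ ⇑g = w₀).card : k) *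
          (((univ.filter fun σ : Equiv.Perm (Fin m) => ∀ i, γ (σ i) = γ i).card : k) *
            ∑ τ : Equiv.Perm (Fin n), spechtCharacter k μ τ *
              ((wordPermRep k m n).subrepresentation X hXc).character τ) := by
        rw [← mul_assoc, hcount', mul_assoc]
    _ = ((univ.filter fun σ : Equiv.Perm (Fin m) => ⇑σ ∘ w₀ = w₀).card : k) *
          ((n.factorial : k) * ∑ τ ∈ univ.filter (fun τ : Equiv.Perm (Fin n) =>
            ∃ σ : Equiv.Perm (Fin m), ⇑σ ∘ w₀ ∘ ⇑τ = w₀), spechtCharacter k μ τ) := by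
        rw [← key]
        ring

/-- **The multiplicity of `[μ]` in the slice space `sliceSpace k m n γ`**:
`|K_γ(w₀)| · ∑_{τ ∈ 𝔖_n} χ^μ(τ) χ_γ(τ) = n! · ∑_{κ ∈ K_γ(w₀)} χ^μ(κ)` for every word `w₀` of
content `γ` and every `μ ⊢ n` (characteristic zero). For `γ = D·ϱ`, `n = dD` (IK 2020 §10) this
computes `dim ({λ}^{Dϱ})^{stab ϱ}` once `({λ}^{Dϱ})^{stab ϱ}` is transported to the word model;
for `γ = (δ^m)` and the block word it is the identity behind BLMW's Cor. 8.4.2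
(`BLMW11PerSliceCharacterProofs.lean`). [cite: FultonHarrisGTM129, §2.2 (2.9) and §3.3]
[cite: IkenmeyerKandasamy2019, §10 (Prop. 10.1)] -/
theorem card_mul_sum_spechtCharacter_mul_character_sliceSpace (γ : Fin m → ℕ) (w₀ : Word m n)
    (hw₀ : wordContent w₀ = γ) (μ : Nat.Partition n) :
    ((univ.filter fun τ : Equiv.Perm (Fin n) =>
        ∃ σ : Equiv.Perm (Fin m), ⇑σ ∘ w₀ ∘ ⇑τ = w₀).card : k) *
      ∑ τ : Equiv.Perm (Fin n), spechtCharacter k μ τ *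
        ((wordPermRep k m n).subrepresentation (sliceSpace k m n γ)
          (sliceSpace_le_comap k γ)).character τ =
      (n.factorial : k) * ∑ τ ∈ univ.filter (fun τ : Equiv.Perm (Fin n) =>
        ∃ σ : Equiv.Perm (Fin m), ⇑σ ∘ w₀ ∘ ⇑τ = w₀), spechtCharacter k μ τ :=
  card_mul_sum_spechtCharacter_mul_character_of_slice k γ _ (mem_sliceSpace_iff γ)
    (sliceSpace_le_comap k γ) w₀ hw₀ μ

/-- **Subgroup form with Schur–Weyl**: if `K ≤ 𝔖_n` is the subgroup
`{τ : ∃ σ, σ ∘ w₀ ∘ τ = w₀}` (`w₀` of content `γ`) and `μ ⊢ n` has at most `N` parts, then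
`∑_{τ ∈ 𝔖_n} χ^μ(τ) χ_γ(τ) = n! · dim (HW_μ((k^N)^{⊗n}))^{K}` — the multiplicity of `[μ]` in the
slice is the dimension of the `K`-invariants of the Specht module, realised on the highest-weight
vectors of weight `μ` in the word model (`hwPermRep`, `character_hwPermRep`; Fulton–Harris (2.9)
for the restriction to `K`). [cite: FultonHarrisGTM129, §2.2 (2.9) and Thm. 6.3 (2)] -/
theorem sum_spechtCharacter_mul_character_sliceSpace_eq_finrank_invariants {N : ℕ}
    (γ : Fin m → ℕ) (w₀ : Word m n) (hw₀ : wordContent w₀ = γ)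
    (K : Subgroup (Equiv.Perm (Fin n)))
    (hK : ∀ τ, τ ∈ K ↔ ∃ σ : Equiv.Perm (Fin m), ⇑σ ∘ w₀ ∘ ⇑τ = w₀)
    (μ : Nat.Partition n) (hμ : μ.parts.card ≤ N) :
    ∑ τ : Equiv.Perm (Fin n), spechtCharacter k μ τ *
        ((wordPermRep k m n).subrepresentation (sliceSpace k m n γ)
          (sliceSpace_le_comap k γ)).character τ =
      (n.factorial : k) * (Module.finrank k (Representation.invariants
        ((hwPermRep k (D := n) (Weight.ofPartition N μ)).comp K.subtype)) : k) := by
  classical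
  have hKcard : Nat.card K = (univ.filter fun τ : Equiv.Perm (Fin n) =>
      ∃ σ : Equiv.Perm (Fin m), ⇑σ ∘ w₀ ∘ ⇑τ = w₀).card := by
    rw [Nat.card_eq_fintype_card]
    exact Fintype.card_of_subtype _ fun τ => by simp [hK]
  have hcard : (Nat.card K : k) ≠ 0 := Nat.cast_ne_zero.mpr Nat.card_pos.ne'
  haveI : Invertible (Nat.card K : k) := invertibleOfNonzero hcard
  have hinv := Representation.card_inv_mul_sum_char_eq_finrank
    ((hwPermRep k (D := n) (Weight.ofPartition N μ)).comp K.subtype)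
  -- the character of the restriction is the Specht character
  have hchar : ∀ κ : K, Representation.character
      ((hwPermRep k (D := n) (Weight.ofPartition N μ)).comp K.subtype) κ =
      spechtCharacter k μ (κ : Equiv.Perm (Fin n)) := by
    intro κ
    rw [← character_hwPermRep k μ hμ]
    rfl
  simp only [hchar] at hinv
  have hKsum : ∑ κ : K, spechtCharacter k μ (κ : Equiv.Perm (Fin n)) =
      ∑ τ ∈ univ.filter (fun τ : Equiv.Perm (Fin n) =>
        ∃ σ : Equiv.Perm (Fin m), ⇑σ ∘ w₀ ∘ ⇑τ = w₀), spechtCharacter k μ τ :=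
    (Finset.sum_subtype _ (fun τ => by simp [hK]) _).symm
  have hsumK : ∑ τ ∈ univ.filter (fun τ : Equiv.Perm (Fin n) =>
        ∃ σ : Equiv.Perm (Fin m), ⇑σ ∘ w₀ ∘ ⇑τ = w₀), spechtCharacter k μ τ =
      (Nat.card K : k) * (Module.finrank k (Representation.invariants
        ((hwPermRep k (D := n) (Weight.ofPartition N μ)).comp K.subtype)) : k) := by
    rw [← hKsum, ← hinv, ← mul_assoc, mul_inv_cancel₀ hcard, one_mul]
  have hmain := card_mul_sum_spechtCharacter_mul_character_sliceSpace k γ w₀ hw₀ μ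
  rw [hsumK, ← hKcard] at hmain
  refine mul_left_cancel₀ hcard ?_
  rw [hmain]
  ring

end Main

/-! ### §4 Generators: the slice space is the joint fixed space of the kernel torus of `γ` and of
the relabellings in `stab γ` -/

section Generators

variable (k : Type*) [Field k] {m n : ℕ}

/-- A diagonal matrix acts on functions of words diagonally, by `∏_i d_i ^ cont_i(w)`
(`wordRep_diagonal_apply`, grouped by letters). [folklore] -/
private theorem wordRep_slice_apply_of_coe_eq_diagonal {g : GL (Fin m) k} {d : Fin m → k}
    (hg : (g : Matrix (Fin m) (Fin m) k) = Matrix.diagonal d) (y : Word m n → k) (w : Word m n) :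
    wordRep k m n g y w = (∏ i, d i ^ wordContent w i) * y w := by
  rw [wordRep_apply, Finset.sum_eq_single w, ← prod_eq_prod_pow_wordContent d w]
  · congr 1
    exact Finset.prod_congr rfl fun p _ => by rw [hg, Matrix.diagonal_apply_eq]
  · intro w' _ hw'
    obtain ⟨p, hp⟩ := Function.ne_iff.1 hw'
    rw [Finset.prod_eq_zero (Finset.mem_univ p), zero_mul]
    rw [hg, Matrix.diagonal_apply_ne _ (Ne.symm hp)]
  · intro h
    exact absurd (Finset.mem_univ w) h

/-- Entries of a permutation matrix. [folklore] -/
private theorem permMatrix_apply'' (σ : Equiv.Perm (Fin m)) (i j : Fin m) :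
    σ.permMatrix k i j = if σ i = j then 1 else 0 := by
  simp only [Equiv.Perm.permMatrix, PEquiv.toMatrix_apply, Equiv.toPEquiv_apply, Option.mem_def,
    Option.some.injEq]

/-- A permutation matrix `P_σ` acts on functions of words by relabelling the letters:
`(P_σ · y)(w) = y (σ ∘ w)`. [folklore] -/
private theorem wordRep_slice_apply_of_coe_eq_permMatrix {g : GL (Fin m) k} {σ : Equiv.Perm (Fin m)}
    (hg : (g : Matrix (Fin m) (Fin m) k) = σ.permMatrix k) (y : Word m n → k) (w : Word m n) :
    wordRep k m n g y w = y (⇑σ ∘ w) := by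
  rw [wordRep_apply, Finset.sum_eq_single (⇑σ ∘ w)]
  · rw [Finset.prod_eq_one (fun p _ => by
      rw [hg, permMatrix_apply'', Function.comp_apply, if_pos rfl]), one_mul]
  · intro w' _ hw'
    obtain ⟨p, hp⟩ := Function.ne_iff.mp hw'
    rw [Finset.prod_eq_zero (Finset.mem_univ p), zero_mul]
    rw [hg, permMatrix_apply'', if_neg]
    intro h
    exact hp (by rw [Function.comp_apply]; exact h.symm)
  · intro h
    exact absurd (Finset.mem_univ _) h

/-- The product over the two-letter diagonal `(…, A at i, …, B at j, …, 1 elsewhere)`. [folklore] -/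
private theorem prod_pow_twoLetter {i j : Fin m} (hij : i ≠ j) (A B : k) (e : Fin m → ℕ) :
    ∏ l, (if l = i then A else if l = j then B else 1) ^ e l = A ^ e i * B ^ e j := by
  rw [← Finset.mul_prod_erase _ _ (Finset.mem_univ i), if_pos rfl,
    ← Finset.mul_prod_erase _ _ (Finset.mem_erase.mpr ⟨hij.symm, Finset.mem_univ j⟩),
    if_neg hij.symm, if_pos rfl, Finset.prod_eq_one, mul_one]
  intro l hl
  rw [Finset.mem_erase, Finset.mem_erase] at hl
  rw [if_neg hl.2.1, if_neg hl.1, one_pow]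

/-- The two-letter element of the kernel torus of `γ`: `2^{γ_j}` at `i`, `2^{-γ_i}` at `j`; its
character value on a word of content `c` is `2^{γ_j c_i - γ_i c_j}`. [folklore] -/
private theorem prod_zpow_twoLetter [CharZero k] {i j : Fin m} (hij : i ≠ j) (γ : Fin m → ℕ)
    (e : Fin m → ℕ) :
    ∏ l, (if l = i then (2 : k) ^ (γ j : ℤ) else if l = j then (2 : k) ^ (-(γ i : ℤ)) else 1) ^ e l =
      (2 : k) ^ ((γ j : ℤ) * e i - (γ i : ℤ) * e j) := by
  rw [prod_pow_twoLetter k hij, ← zpow_natCast, ← zpow_natCast, ← zpow_mul, ← zpow_mul,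
    ← zpow_add₀ (two_ne_zero : (2 : k) ≠ 0)]
  congr 1
  ring

/-- **The slice space by generators** (characteristic zero, `|γ| = n`): a function of words lies
in `sliceSpace k m n γ` iff it is fixed by every element of the kernel torus of `γ`
(`diag(d)` with `∏_i d_i^{γ_i} = 1`) and by every permutation matrix `P_σ`, `σ ∈ stab γ`. This is
the dictionary `sliceSpace k m n γ = (((k^m)^{⊗n})^γ)^{stab γ} = ((k^m)^{⊗n})^{H_γ}`,
`H_γ = T_γ ⋊ stab γ`, used to transport IK's `({λ}^{Dϱ})^{stab ϱ}` (stated for arbitrary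
`g ∈ GL_m` with the given matrix, so that either permutation-matrix convention applies).
[cite: IkenmeyerKandasamy2019, §10 (Claim 10.2)] -/
theorem mem_sliceSpace_iff_forall_wordRep_eq [CharZero k] (γ : Fin m → ℕ) (hγ : ∑ i, γ i = n)
    (y : Word m n → k) :
    y ∈ sliceSpace k m n γ ↔
      (∀ (d : Fin m → k) (g : GL (Fin m) k), (g : Matrix (Fin m) (Fin m) k) = Matrix.diagonal d →
          ∏ i, d i ^ γ i = 1 → wordRep k m n g y = y) ∧
      ∀ (σ : Equiv.Perm (Fin m)) (g : GL (Fin m) k),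
        (g : Matrix (Fin m) (Fin m) k) = σ.permMatrix k → (∀ i, γ (σ i) = γ i) →
          wordRep k m n g y = y := by
  constructor
  · rintro ⟨hsupp, hinv⟩
    refine ⟨fun d g hg hd => ?_, fun σ g hg hσ => ?_⟩
    · funext w
      rw [wordRep_slice_apply_of_coe_eq_diagonal k hg]
      by_cases hw : wordContent w = γ
      · rw [hw, hd, one_mul]
      · rw [hsupp w hw, mul_zero]
    · funext w
      rw [wordRep_slice_apply_of_coe_eq_permMatrix k hg]
      exact hinv σ hσ w
  · rintro ⟨htorus, hperm⟩
    refine ⟨fun u hu => ?_, fun σ hσ u => ?_⟩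
    · -- support: the two-letter torus elements force `cont(u) ∥ γ`, hence `cont(u) = γ`
      by_contra hyu
      apply hu
      have hpar : ∀ i j : Fin m, γ j * wordContent u i = γ i * wordContent u j := by
        intro i j
        rcases eq_or_ne i j with rfl | hij
        · rfl
        set d : Fin m → k := fun l =>
          if l = i then (2 : k) ^ (γ j : ℤ) else if l = j then (2 : k) ^ (-(γ i : ℤ)) else 1 with hd
        have hd0 : (Matrix.diagonal d).det ≠ 0 := by
          rw [Matrix.det_diagonal]
          refine Finset.prod_ne_zero_iff.mpr fun l _ => ?_
          simp only [hd]
          split_ifs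
          · exact zpow_ne_zero _ two_ne_zero
          · exact zpow_ne_zero _ two_ne_zero
          · exact one_ne_zero
        have hker : ∏ l, d l ^ γ l = 1 := by
          rw [hd, prod_zpow_twoLetter k hij γ γ]
          have : (γ j : ℤ) * (γ i) - (γ i : ℤ) * (γ j) = 0 := by ring
          rw [this, zpow_zero]
        have hfix := congr_fun (htorus d (Matrix.GeneralLinearGroup.mkOfDetNeZero _ hd0)
          (Matrix.GeneralLinearGroup.val_mkOfDetNeZero _ _) hker) u
        rw [wordRep_slice_apply_of_coe_eq_diagonal k (Matrix.GeneralLinearGroup.val_mkOfDetNeZero _ _),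
          mul_left_eq_self₀] at hfix
        have hone : ∏ l, d l ^ wordContent u l = 1 := hfix.resolve_right hyu
        rw [hd, prod_zpow_twoLetter k hij γ (wordContent u), ← zpow_zero (2 : k)] at hone
        have hz := two_zpow_injective k hone
        have : ((γ j * wordContent u i : ℕ) : ℤ) = ((γ i * wordContent u j : ℕ) : ℤ) := by
          push_cast
          linarith
        exact_mod_cast this
      -- `n · cont_i(u) = γ_i · n`
      funext i
      have hsum : (∑ j, γ j) * wordContent u i = γ i * ∑ j, wordContent u j := by
        rw [Finset.sum_mul, Finset.mul_sum]
        exact Finset.sum_congr rfl fun j _ => hpar i j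
      rw [hγ, sum_wordContent] at hsum
      rcases Nat.eq_zero_or_pos n with hn | hn
      · have h1 : wordContent u i ≤ ∑ j, wordContent u j :=
          Finset.single_le_sum (fun _ _ => Nat.zero_le _) (Finset.mem_univ i)
        have h2 : γ i ≤ ∑ j, γ j := Finset.single_le_sum (fun _ _ => Nat.zero_le _) (Finset.mem_univ i)
        rw [sum_wordContent] at h1
        rw [hγ] at h2
        omega
      · exact Nat.eq_of_mul_eq_mul_left hn (by rw [hsum, mul_comm])
    · -- relabelling
      have hdet : (σ.permMatrix k).det ≠ 0 := by
        rw [Matrix.det_permutation]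
        rcases Int.units_eq_one_or σ.sign with h | h <;> simp [h]
      have hfix := congr_fun (hperm σ (Matrix.GeneralLinearGroup.mkOfDetNeZero _ hdet)
        (Matrix.GeneralLinearGroup.val_mkOfDetNeZero _ _) hσ) u
      rw [wordRep_slice_apply_of_coe_eq_permMatrix k (Matrix.GeneralLinearGroup.val_mkOfDetNeZero _ _)]
        at hfix
      exact hfix

end Generators

/-! ### §5 Young symmetrizer images inside a stable subspace: `c_μ · M ∩ X = c_μ · X` -/

section YoungImage

variable {k : Type*} [Field k] {n : ℕ} {M : Type*} [AddCommGroup M] [Module k M]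

/-- A subspace stable under the group is stable under the group algebra. [folklore] -/
private theorem asAlgebraHom_mem_of_forall_mem' {G : Type*} [Group G] (ρ : Representation k G M)
    (X : Submodule k M) (hX : ∀ g, ∀ v ∈ X, ρ g v ∈ X) (a : MonoidAlgebra k G) {v : M}
    (hv : v ∈ X) : ρ.asAlgebraHom a v ∈ X := by
  induction a using MonoidAlgebra.induction_on with
  | hM g => rw [Representation.asAlgebraHom_of]; exact hX g v hv
  | hadd a b ha hb => rw [map_add, LinearMap.add_apply]; exact add_mem ha hb
  | hsmul r a ha => rw [map_smul, LinearMap.smul_apply]; exact Submodule.smul_mem _ r ha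

/-- **`c_μ · M ∩ X = c_μ · X`** for a representation `M` of `𝔖_n`, an `𝔖_n`-stable subspace `X` and
a Young symmetrizer `c_μ` (characteristic zero): `⊇` because `X` is stable under `k[𝔖_n]`, `⊆`
because `c_μ v = n_μ v` on `c_μ · M` (`c_μ² = n_μ c_μ`, `n_μ ≠ 0`, Fulton–Harris Lemma 4.26), so
`v = c_μ (n_μ⁻¹ v)`. With `X` a slice space and `M` all functions of words this identifies the
`γ`-weight, `stab γ`-fixed part of the Weyl module `c_λ · (k^m)^{⊗n}` with `c_λ · sliceSpace`,
whose dimension `factorial_mul_finrank_range_youngSymmetrizer` and §3 compute (route to IK 2020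
Prop. 10.1). [cite: FultonHarrisGTM129, Lemma 4.26] -/
theorem range_youngSymmetrizer_inf_eq_map [CharZero k] (ρ : Representation k (Equiv.Perm (Fin n)) M)
    (X : Submodule k M) (hX : ∀ g, ∀ v ∈ X, ρ g v ∈ X) (μ : Nat.Partition n) :
    LinearMap.range (ρ.asAlgebraHom (youngSymmetrizer k μ)) ⊓ X =
      X.map (ρ.asAlgebraHom (youngSymmetrizer k μ)) := by
  apply le_antisymm
  · rintro v ⟨⟨u, rfl⟩, hv⟩
    have hn : (youngSymmetrizer k μ * youngSymmetrizer k μ).coeff 1 ≠ 0 :=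
      coeff_sq_youngSymmetrizer_ne_zero k μ
    have hcc : ρ.asAlgebraHom (youngSymmetrizer k μ) (ρ.asAlgebraHom (youngSymmetrizer k μ) u) =
        (youngSymmetrizer k μ * youngSymmetrizer k μ).coeff 1 • ρ.asAlgebraHom (youngSymmetrizer k μ) u := by
      conv_lhs => rw [← Module.End.mul_apply, ← map_mul, youngSymmetrizer_sq k μ, map_smul]
      rw [LinearMap.smul_apply]
    refine ⟨((youngSymmetrizer k μ * youngSymmetrizer k μ).coeff 1)⁻¹ •
      ρ.asAlgebraHom (youngSymmetrizer k μ) u, X.smul_mem _ hv, ?_⟩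
    rw [map_smul, hcc, smul_smul, inv_mul_cancel₀ hn, one_smul]
  · rintro _ ⟨x, hx, rfl⟩
    exact ⟨⟨x, rfl⟩, asAlgebraHom_mem_of_forall_mem' ρ X hX _ hx⟩

/-- The group algebra acts on a subrepresentation by restriction (coercion lemma). [folklore] -/
private theorem coe_subrepresentation_asAlgebraHom {G : Type*} [Group G] (ρ : Representation k G M)
    (X : Submodule k M) (hX : ∀ g, X ≤ X.comap (ρ g)) (a : MonoidAlgebra k G) (x : X) :
    (((ρ.subrepresentation X hX).asAlgebraHom a x : X) : M) = ρ.asAlgebraHom a x := by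
  induction a using MonoidAlgebra.induction_on with
  | hM g => rw [Representation.asAlgebraHom_of, Representation.asAlgebraHom_of]; rfl
  | hadd a b ha hb => rw [map_add, map_add, LinearMap.add_apply, LinearMap.add_apply,
      Submodule.coe_add, ha, hb]
  | hsmul r a ha => rw [map_smul, map_smul, LinearMap.smul_apply, LinearMap.smul_apply,
      Submodule.coe_smul, ha]

/-- **`dim c_μ · X = dim (c_μ · M ∩ X)`**: the image of the Young symmetrizer acting on the
subrepresentation `X` (whose dimension is `⟨χ^μ, χ_X⟩`, `factorial_mul_finrank_range_youngSymmetrizer`)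
is, inside `M`, the intersection of `c_μ · M` with `X`. [cite: FultonHarrisGTM129, Lemma 4.26] -/
theorem finrank_range_youngSymmetrizer_subrepresentation [CharZero k]
    (ρ : Representation k (Equiv.Perm (Fin n)) M) (X : Submodule k M)
    (hX : ∀ g, X ≤ X.comap (ρ g)) (μ : Nat.Partition n) :
    Module.finrank k (LinearMap.range
        ((ρ.subrepresentation X hX).asAlgebraHom (youngSymmetrizer k μ))) =
      Module.finrank k ↥(LinearMap.range (ρ.asAlgebraHom (youngSymmetrizer k μ)) ⊓ X) := by
  have hmap : (LinearMap.range ((ρ.subrepresentation X hX).asAlgebraHom (youngSymmetrizer k μ))).map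
      X.subtype = X.map (ρ.asAlgebraHom (youngSymmetrizer k μ)) := by
    ext v
    constructor
    · rintro ⟨y, ⟨x, rfl⟩, rfl⟩
      exact ⟨x, x.2, (coe_subrepresentation_asAlgebraHom ρ X hX _ x).symm⟩
    · rintro ⟨x, hx, rfl⟩
      exact ⟨(ρ.subrepresentation X hX).asAlgebraHom (youngSymmetrizer k μ) ⟨x, hx⟩,
        ⟨⟨x, hx⟩, rfl⟩, coe_subrepresentation_asAlgebraHom ρ X hX _ ⟨x, hx⟩⟩
  rw [← Submodule.finrank_map_subtype_eq, hmap,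
    range_youngSymmetrizer_inf_eq_map ρ X (fun g v hv => hX g hv) μ]

end YoungImage

/-! ### §6 Weight vectors in the word model are the functions supported on one content -/

section WeightSupport

variable (k : Type*) [Field k] [CharZero k] {m n : ℕ}

/-- **The weight space of weight `γ ≥ 0` of `(k^m)^{⊗n}` in the word model is the space of
functions supported on the words of content `γ`** (characteristic zero): `e_w` is a weight vector
of weight `cont(w)` (`wordRep_diagonal_apply`), and distinct contents are separated by the torus
(`apply_eq_zero_of_mem_weightSpace`). Together with §4 this identifies
`sliceSpace k m n γ = (((k^m)^{⊗n})^γ)^{stab γ}` (first hypothesis of `mem_sliceSpace_iff`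
= membership in the weight space). Fulton, *Young Tableaux*, §8.2; Goodman–Wallach §9.1.1.
[cite: FultonHarrisGTM129, §15.3 (weights of tensor powers)] -/
theorem mem_weightSpace_wordRep_iff_support (γ : Fin m → ℕ) (y : Word m n → k) :
    y ∈ weightSpace (wordRep k m n) (fun i => (γ i : ℤ)) ↔
      ∀ u : Word m n, wordContent u ≠ γ → y u = 0 := by
  constructor
  · intro hy u hu
    obtain ⟨i, hi⟩ := Function.ne_iff.mp hu
    exact apply_eq_zero_of_mem_weightSpace k hy (i := i) (by exact_mod_cast hi)
  · intro hy
    rw [mem_weightSpace_iff]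
    intro t ht
    have hdiag : (t : Matrix (Fin m) (Fin m) k) =
        Matrix.diagonal (fun i => (t : Matrix (Fin m) (Fin m) k) i i) :=
      (((isDiagonalGL_iff_isDiag t).mp ht).diagonal_diag).symm
    funext w
    rw [wordRep_slice_apply_of_coe_eq_diagonal k hdiag, Pi.smul_apply, smul_eq_mul]
    by_cases hw : wordContent w = γ
    · congr 1
      rw [weightChar]
      refine Finset.prod_congr rfl fun i _ => ?_
      rw [← zpow_natCast, hw]
    · rw [hy w hw, mul_zero, mul_zero]

end WeightSupport

/-! ### §7 From tensors to words: `wordCoord` carries `c_λ · (k^m)^{⊗n}` onto `c_λ · (functions of words)` -/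

section TensorTransport

variable (k : Type*) [Field k] (m n : ℕ)

/-- Coordinates of the position action: `wordCoord (τ · v) = τ · wordCoord v`
(`tensorBasis_repr_permTensorRep` in the letters of `TensorWordModel`; the action of `𝔖_n` on
`V^{⊗n}` in the basis of words, Fulton–Harris §6.1). [cite: FultonHarrisGTM129, §6.1 Lemma 6.22] -/
theorem wordCoord_permTensorRep_apply (τ : Equiv.Perm (Fin n)) (v : TensorPower k n (Fin m → k)) :
    wordCoord k m n (permTensorRep k (Fin m → k) n τ v) = wordPerm k τ (wordCoord k m n v) := by
  funext w
  rw [wordPerm_apply, wordCoord_eq_repr, wordCoord_eq_repr, tensorBasis_repr_permTensorRep]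

/-- `wordCoord` intertwines the two actions of the group algebra `k[𝔖_n]` on `V^{⊗n}` and on the
functions of words (Fulton–Harris §6.1: `ℂ[𝔖_n]` acting on `V^{⊗n}` on the right, in coordinates).
[cite: FultonHarrisGTM129, §6.1 Lemma 6.22] -/
theorem wordCoord_asAlgebraHom_permTensorRep (a : MonoidAlgebra k (Equiv.Perm (Fin n)))
    (v : TensorPower k n (Fin m → k)) :
    wordCoord k m n ((permTensorRep k (Fin m → k) n).asAlgebraHom a v) =
      (wordPermRep k m n).asAlgebraHom a (wordCoord k m n v) := by
  induction a using MonoidAlgebra.induction_on with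
  | hM τ =>
    rw [Representation.asAlgebraHom_of, Representation.asAlgebraHom_of, wordPermRep_apply,
      wordCoord_permTensorRep_apply]
  | hadd a b ha hb =>
    rw [map_add, map_add, LinearMap.add_apply, LinearMap.add_apply, map_add, ha, hb]
  | hsmul r a ha =>
    rw [map_smul, map_smul, LinearMap.smul_apply, LinearMap.smul_apply, map_smul, ha]

/-- **`wordCoord` maps the Weyl module `{λ} = c_λ · (k^m)^{⊗n}` onto `c_λ ·` (functions of words)**
(Weyl's construction read in coordinates; Fulton–Harris §6.1, Lemma 6.22). With §5–§6 and §4: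
the `γ`-weight, `stab γ`-fixed part of `{λ}` corresponds to `c_λ · sliceSpace k m n γ`, whose
dimension `factorial_mul_finrank_range_youngSymmetrizer` and §3 compute (route to IK 2020
Prop. 10.1). [cite: FultonHarrisGTM129, §6.1 Lemma 6.22] -/
theorem map_wordCoord_weylModule (lam : Nat.Partition n) :
    (weylModule k (Fin m) lam).map (wordCoord k m n).toLinearMap =
      LinearMap.range ((wordPermRep k m n).asAlgebraHom (youngSymmetrizer k lam)) := by
  apply le_antisymm
  · rintro _ ⟨v, ⟨u, rfl⟩, rfl⟩
    exact ⟨wordCoord k m n u, (wordCoord_asAlgebraHom_permTensorRep k m n _ u).symm⟩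
  · rintro _ ⟨x, rfl⟩
    refine ⟨(permTensorRep k (Fin m → k) n).asAlgebraHom (youngSymmetrizer k lam)
      ((wordCoord k m n).symm x), ⟨(wordCoord k m n).symm x, rfl⟩, ?_⟩
    rw [LinearEquiv.coe_coe, wordCoord_asAlgebraHom_permTensorRep, LinearEquiv.apply_symm_apply]

/-- Dimension form of Weyl's construction in coordinates: `dim ({λ} ⊓ wordCoord⁻¹ Y) =
dim (c_λ · words ⊓ Y)` for every subspace `Y` of functions of words (`{λ} = c_λ · V^{⊗n}`,
Fulton–Harris §6.1, transported along the coordinate isomorphism `wordCoord`).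
[cite: FultonHarrisGTM129, §6.1 Lemma 6.22] -/
theorem finrank_weylModule_inf_comap_wordCoord (lam : Nat.Partition n)
    (Y : Submodule k (Word m n → k)) :
    Module.finrank k ↥(weylModule k (Fin m) lam ⊓ Y.comap (wordCoord k m n).toLinearMap) =
      Module.finrank k ↥(LinearMap.range ((wordPermRep k m n).asAlgebraHom (youngSymmetrizer k lam))
        ⊓ Y) := by
  rw [← LinearEquiv.finrank_map_eq (wordCoord k m n)
    (weylModule k (Fin m) lam ⊓ Y.comap (wordCoord k m n).toLinearMap),
    ← Submodule.map_inf_eq_map_inf_comap, map_wordCoord_weylModule]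

end TensorTransport

end Literature.Computability.AlgebraicComplexity

end
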